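import Summits.CriticalPhenomena.SAWScalingLimit.Theorems.SAWLeftRightFKGLeftRightFKGStubClassDictionary
import Summits.CriticalPhenomena.SAWScalingLimit.Theorems.SAWLeftRightFKGLeftRightFKGStubCornerAssemblyKernel
import Summits.CriticalPhenomena.SAWScalingLimit.Theorems.SAWTotalPositivityBoundaryTP2Kernel
import Summits.CriticalPhenomena.SAWScalingLimit.Theorems.SAWTotalPositivityBoundaryTP2Symmetry
import Summits.CriticalPhenomena.SAWScalingLimit.Theorems.SAWLeftRightFKGLeftRightFKGFirstStepMonotone
import Summits.CriticalPhenomena.SAWScalingLimit.Theorems.LeftRightFKG.Negative.RectMesh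
import HarnessLib

/-!
# Crux `LeftRightFKG` (stmt-CriticalPhenomena-11232), line `corner-localisation` (lead c4, v9):
what the crux quantifies on boxes — the leaf three-point inequality (`stub_boxLeafThreePoint`, T5)

For every lattice rectangle realised as the crux domain `dom C 1` by a boundary walk `C` (side conditions of
`Negative.Rect.meshDomain_Ω`) and marked points `a = (i, y₀+1)`, `b = (i+2, y₀+1)` on the bottom row with common
neighbour `c`, the crux `…Theses.SAWLeftRightFKG.LeftRightFKG` APPLIED to the events `E = {first step ≠ c}`,
`F = {last step not from c}` (`≼`-up-closed by the landed `Families.stub_firstStepMonotone`) is, through the class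
dictionary at `k = m = 0` (`CornerLoc.stub_classDictionary`: chords with end-steps `(u', w')` ≃ self-avoiding paths
`u' → w'` of the free graph `G` = box graph with `a, b` isolated, lengths `+ 2`), the THREE-POINT INEQUALITY AT THE
LEAF `c` OF `G`: `(Z(u,c) + Z(wₐ,c)) (Z(c,w) + Z(c,e')) ≤ Σ_{u' ∈ {u,wₐ}, w' ∈ {w,e'}} Z(u',w')`, `Z = pathKernel G x_c`
(kernels at wall sites vanish). Bookkeeping: chords are partitioned by their end-steps
`(u', w') ∈ {c, u, wₐ} × {c, w, e'}`, the entry `M(u',w')` of the end-step matrix is `x_c² Z(u',w')`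
(`CornerAssembly.sum_dirSet_eq`; `M(c,c) = x_c²`, the chord `a c b`), and `w(E) w(F) ≤ w(univ) w(E ∩ F)` reads
`(Cc + N)(R + N) ≤ (M(c,c) + R + Cc + N) N`, i.e. `Cc · R ≤ M(c,c) · N`. Elementary given the landed stubs ("folklore").
-/

noncomputable section

open MeasureTheory SimpleGraph
open Literature.Probability.LatticeModels Literature.Probability.RandomPlanarGeometry
open Summit.CriticalPhenomena.SAWScalingLimit.Theorems.LeftRightFKG.Negative (bx pathCross wcross)
open Summit.CriticalPhenomena.SAWScalingLimit.Theorems.LeftRightFKG.CornerLoc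
open Summit.CriticalPhenomena.SAWScalingLimit.Theorems.BoundaryTP2 (pathKernel pathKernelOn)
open scoped Classical ENNReal

namespace Summit.CriticalPhenomena.SAWScalingLimit.Theorems.LeftRightFKG.Families

namespace BoxLeafThreePoint

/-- Explicit sites are equal iff their coordinates are. [folklore] -/
theorem bx_eq_iff {i j i' j' : ℤ} : bx i j = bx i' j' ↔ i = i' ∧ j = j' :=
  ⟨fun e => ⟨by simpa using congrArg (· 0) e, by simpa using congrArg (· 1) e⟩, fun h => by rw [h.1, h.2]⟩

/-- Sites with a different coordinate differ. [folklore] -/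
theorem site_ne {p q : Site 2} (h : p 0 ≠ q 0 ∨ p 1 ≠ q 1) : p ≠ q := by
  rintro rfl
  simp at h

/-- The lattice neighbours INSIDE the open box of a site `p` on the row just above the bottom wall are
`p + e₀`, `p + e₁`, `p - e₀` (the southern neighbour is on the wall). [folklore] -/
theorem nbr_cases {x₀ x₁ y₀ y₁ : ℤ} {p v : Site 2} (h : (zdGraph 2).Adj p v)
    (hv : v ∈ Negative.Rect.box x₀ x₁ y₀ y₁) (hp : p 1 = y₀ + 1) :
    v = bx (p 0 + 1) (y₀ + 1) ∨ v = bx (p 0) (y₀ + 2) ∨ v = bx (p 0 - 1) (y₀ + 1) := by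
  have hcs := Negative.adj_cases h
  obtain ⟨-, hv1, -⟩ := hv
  rw [Negative.eq_bx v]
  simp only [bx_eq_iff]
  omega

/-- A vertex outside the support of a graph reaches only itself. [folklore] -/
theorem not_reachable_of_not_mem_support {V : Type*} {H : SimpleGraph V} {v w : V}
    (hv : v ∉ H.support) (hne : v ≠ w) : ¬ H.Reachable v w := by
  rintro ⟨p⟩
  cases p with
  | nil => exact hne rfl
  | cons h _ => exact hv ((SimpleGraph.mem_support _).2 ⟨_, h⟩)

/-- In the open box (adjacency of `Ω_1` = lattice adjacency inside the box) there are two distinct chords from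
`a = (i, y₀+1)` to `b = (i+2, y₀+1)`: `a c b` and `a, (i,y₀+2), (i+1,y₀+2), (i+2,y₀+2), b`. [folklore] -/
theorem two_chords {Ω : Set ℂ} {x₀ x₁ y₀ y₁ i : ℤ}
    (hadj : ∀ p q : Site 2, (discreteDomainGraph Ω 1).Adj p q ↔
      (zdGraph 2).Adj p q ∧ p ∈ Negative.Rect.box x₀ x₁ y₀ y₁ ∧ q ∈ Negative.Rect.box x₀ x₁ y₀ y₁)
    (hi : x₀ < i) (hi' : i + 2 < x₁) (hy : y₀ + 2 < y₁) {a b : Site 2} (ha : a = bx i (y₀ + 1))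
    (hb : b = bx (i + 2) (y₀ + 1)) : ∃ γ₁ γ₂ : SAW.DomainSAW Ω 1 a b, γ₁ ≠ γ₂ := by
  subst ha hb
  have hA : ∀ {i₁ j₁ i₂ j₂ : ℤ},
      ((x₀ < i₁ ∧ i₁ < x₁) ∧ (y₀ < j₁ ∧ j₁ < y₁)) ∧ ((x₀ < i₂ ∧ i₂ < x₁) ∧ (y₀ < j₂ ∧ j₂ < y₁)) ∧
        ((i₂ = i₁ + 1 ∧ j₂ = j₁) ∨ (i₁ = i₂ + 1 ∧ j₂ = j₁) ∨ (j₂ = j₁ + 1 ∧ i₂ = i₁) ∨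
          (j₁ = j₂ + 1 ∧ i₂ = i₁)) →
      (discreteDomainGraph Ω 1).Adj (bx i₁ j₁) (bx i₂ j₂) := fun ⟨h1, h2, h⟩ =>
    (hadj _ _).2 ⟨Negative.adj_bx _ _ _ _ h, h1, h2⟩
  refine ⟨⟨Walk.cons (hA (i₂ := i + 1) (j₂ := y₀ + 1) (by omega))
      (Walk.cons (hA (i₂ := i + 2) (j₂ := y₀ + 1) (by omega)) Walk.nil), Walk.IsPath.mk' ?_⟩,
    ⟨Walk.cons (hA (i₂ := i) (j₂ := y₀ + 2) (by omega))
      (Walk.cons (hA (i₂ := i + 1) (j₂ := y₀ + 2) (by omega))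
        (Walk.cons (hA (i₂ := i + 2) (j₂ := y₀ + 2) (by omega))
          (Walk.cons (hA (i₂ := i + 2) (j₂ := y₀ + 1) (by omega)) Walk.nil))), Walk.IsPath.mk' ?_⟩,
    fun h => ?_⟩
  · simp [bx_eq_iff]
  · simp [bx_eq_iff]
  · have hl := congrArg SAW.DomainSAW.length h
    simp [SAW.DomainSAW.length] at hl

/-- POINTWISE BOOKKEEPING: for a chord with first step `r ∈ {c, u, wₐ}` and last step `s ∈ {e, w, c}`, the indicators
of `E = {r ≠ c}`, `F = {s ≠ c}`, `univ`, `E ∩ F` are the sums of the indicators of the end-step classes they contain.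
[folklore] -/
theorem pointwise {α : Type*} [DecidableEq α] (f : ℝ) {r s c u wa w e : α} (hr : r = c ∨ r = u ∨ r = wa)
    (hs : s = e ∨ s = w ∨ s = c) (hcu : c ≠ u) (hcwa : c ≠ wa) (huwa : u ≠ wa) (hcw : c ≠ w) (hce : c ≠ e)
    (hwe : w ≠ e) :
    ((if r ≠ c then f else 0) =
      (if r = u ∧ s = c then f else 0) + (if r = u ∧ s = w then f else 0) + (if r = u ∧ s = e then f else 0) +
      (if r = wa ∧ s = c then f else 0) + (if r = wa ∧ s = w then f else 0) +
      (if r = wa ∧ s = e then f else 0)) ∧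
    ((if s ≠ c then f else 0) =
      (if r = c ∧ s = w then f else 0) + (if r = c ∧ s = e then f else 0) + (if r = u ∧ s = w then f else 0) +
      (if r = u ∧ s = e then f else 0) + (if r = wa ∧ s = w then f else 0) +
      (if r = wa ∧ s = e then f else 0)) ∧
    (f = (if r = c ∧ s = c then f else 0) + (if r = c ∧ s = w then f else 0) + (if r = c ∧ s = e then f else 0) +
      (if r = u ∧ s = c then f else 0) + (if r = u ∧ s = w then f else 0) + (if r = u ∧ s = e then f else 0) +
      (if r = wa ∧ s = c then f else 0) + (if r = wa ∧ s = w then f else 0) +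
      (if r = wa ∧ s = e then f else 0)) ∧
    ((if r ≠ c ∧ s ≠ c then f else 0) =
      (if r = u ∧ s = w then f else 0) + (if r = u ∧ s = e then f else 0) +
      (if r = wa ∧ s = w then f else 0) + (if r = wa ∧ s = e then f else 0)) := by
  rcases hr with rfl | rfl | rfl <;> rcases hs with rfl | rfl | rfl <;>
    simp [hcu, hcu.symm, hcwa, hcwa.symm, huwa, huwa.symm, hcw, hcw.symm, hce, hce.symm, hwe, hwe.symm]

end BoxLeafThreePoint

open BoxLeafThreePoint in
/-- STUB T5 `stub_boxLeafThreePoint` of line `corner-localisation` (crux `LeftRightFKG`, stmt-CriticalPhenomena-11232):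
WHAT THE CRUX QUANTIFIES ON BOXES. For every lattice rectangle realised as `dom C 1` by a boundary walk `C` and
marked points `a = (i, y₀+1)`, `b = (i+2, y₀+1)` on the bottom row (common neighbour `c = (i+1, y₀+1)`), the crux's
inequality for the up-closed events `E = {first step ≠ c}`, `F = {last step ≠ c}` is, through the class dictionary at
`k = m = 0`, EXACTLY the three-point inequality at the leaf `c` of the free graph `G` (the box graph with `a, b`
isolated): `(Z(u,c) + Z(wₐ,c)) · (Z(c,w) + Z(c,e')) ≤ Σ_{u' ∈ {u,wₐ}, w' ∈ {w,e'}} Z(u',w')`, `u = (i,y₀+2)`,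
`wₐ = (i-1,y₀+1)`, `w = (i+2,y₀+2)`, `e' = (i+3,y₀+1)`, `Z = pathKernel G x_c` (kernels at wall sites vanish). [folklore] -/
theorem stub_boxLeafThreePoint : Summit.CriticalPhenomena.SAWScalingLimit.Theses.SAWLeftRightFKG.LeftRightFKG →
    ∀ (x₀ x₁ y₀ y₁ i : ℤ) (C : (zdGraph 2).Walk (bx x₀ y₀) (bx x₀ y₀)),
      (∀ x ∈ C.support, (x₀ ≤ x 0 ∧ x 0 ≤ x₁) ∧ (y₀ ≤ x 1 ∧ x 1 ≤ y₁)) →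
      List.IsChain (fun p q : Site 2 => (p 1 = y₀ ∧ q 1 = y₀) ∨ (p 0 = x₁ ∧ q 0 = x₁) ∨
        (p 1 = y₁ ∧ q 1 = y₁) ∨ (p 0 = x₀ ∧ q 0 = x₀)) (bx x₀ y₀ :: C.support.tail) →
      (∀ i' j : ℤ, x₀ ≤ i' → i' ≤ x₁ → y₀ ≤ j → j ≤ y₁ → (i' = x₀ ∨ i' = x₁ ∨ j = y₀ ∨ j = y₁) →
        bx i' j ∈ C.support) →
      pathCross x₀ y₀ (bx x₀ y₀) C.support.tail = -1 →
      x₀ < i → i + 2 < x₁ → y₀ + 2 < y₁ →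
      ∀ G : SimpleGraph (Site 2), G = freeGraph (dom C 1) 1 0 (fun _ => bx i (y₀ + 1)) 0 (fun _ => bx (i + 2) (y₀ + 1)) →
        (pathKernel G SAW.criticalFugacity (bx i (y₀ + 2)) (bx (i + 1) (y₀ + 1)) +
            pathKernel G SAW.criticalFugacity (bx (i - 1) (y₀ + 1)) (bx (i + 1) (y₀ + 1))) *
          (pathKernel G SAW.criticalFugacity (bx (i + 1) (y₀ + 1)) (bx (i + 2) (y₀ + 2)) +
            pathKernel G SAW.criticalFugacity (bx (i + 1) (y₀ + 1)) (bx (i + 3) (y₀ + 1))) ≤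
        pathKernel G SAW.criticalFugacity (bx i (y₀ + 2)) (bx (i + 2) (y₀ + 2)) +
          pathKernel G SAW.criticalFugacity (bx i (y₀ + 2)) (bx (i + 3) (y₀ + 1)) +
          pathKernel G SAW.criticalFugacity (bx (i - 1) (y₀ + 1)) (bx (i + 2) (y₀ + 2)) +
          pathKernel G SAW.criticalFugacity (bx (i - 1) (y₀ + 1)) (bx (i + 3) (y₀ + 1)) := by
  intro hLR x₀ x₁ y₀ y₁ i C hbd hch hcomp hpc hi hi' hy G hG
  set x : ℝ := SAW.criticalFugacity
  have hx0 : 0 < x := SAW.criticalFugacity_pos_lt_one'.1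
  -- names and coordinates of the seven sites
  obtain ⟨a, ha⟩ : ∃ a : Site 2, a = bx i (y₀ + 1) := ⟨_, rfl⟩
  obtain ⟨b, hb⟩ : ∃ b : Site 2, b = bx (i + 2) (y₀ + 1) := ⟨_, rfl⟩
  obtain ⟨c, hc⟩ : ∃ c : Site 2, c = bx (i + 1) (y₀ + 1) := ⟨_, rfl⟩
  obtain ⟨u, hu⟩ : ∃ u : Site 2, u = bx i (y₀ + 2) := ⟨_, rfl⟩
  obtain ⟨wa, hwa⟩ : ∃ wa : Site 2, wa = bx (i - 1) (y₀ + 1) := ⟨_, rfl⟩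
  obtain ⟨w, hw⟩ : ∃ w : Site 2, w = bx (i + 2) (y₀ + 2) := ⟨_, rfl⟩
  obtain ⟨e, he⟩ : ∃ e : Site 2, e = bx (i + 3) (y₀ + 1) := ⟨_, rfl⟩
  rw [← ha, ← hb] at hG
  rw [← hc, ← hu, ← hwa, ← hw, ← he]
  obtain ⟨ha0, ha1⟩ : a 0 = i ∧ a 1 = y₀ + 1 := by subst ha; exact ⟨rfl, rfl⟩
  obtain ⟨hb0, hb1⟩ : b 0 = i + 2 ∧ b 1 = y₀ + 1 := by subst hb; exact ⟨rfl, rfl⟩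
  obtain ⟨hc0, hc1⟩ : c 0 = i + 1 ∧ c 1 = y₀ + 1 := by subst hc; exact ⟨rfl, rfl⟩
  obtain ⟨hu0, hu1⟩ : u 0 = i ∧ u 1 = y₀ + 2 := by subst hu; exact ⟨rfl, rfl⟩
  obtain ⟨hwa0, hwa1⟩ : wa 0 = i - 1 ∧ wa 1 = y₀ + 1 := by subst hwa; exact ⟨rfl, rfl⟩
  obtain ⟨hw0, hw1⟩ : w 0 = i + 2 ∧ w 1 = y₀ + 2 := by subst hw; exact ⟨rfl, rfl⟩
  obtain ⟨he0, he1⟩ : e 0 = i + 3 ∧ e 1 = y₀ + 1 := by subst he; exact ⟨rfl, rfl⟩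
  have hbox : ∀ p : Site 2, p ∈ Negative.Rect.box x₀ x₁ y₀ y₁ ↔
      (x₀ < p 0 ∧ p 0 < x₁) ∧ (y₀ < p 1 ∧ p 1 < y₁) := fun p => Iff.rfl
  obtain ⟨hcu, hcwa, huwa, hcw, hce, hwe, hab⟩ :
      c ≠ u ∧ c ≠ wa ∧ u ≠ wa ∧ c ≠ w ∧ c ≠ e ∧ w ≠ e ∧ a ≠ b :=
    ⟨site_ne (Or.inl (by omega)), site_ne (Or.inl (by omega)), site_ne (Or.inl (by omega)),
      site_ne (Or.inl (by omega)), site_ne (Or.inl (by omega)), site_ne (Or.inl (by omega)),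
      site_ne (Or.inl (by omega))⟩
  obtain ⟨hca, hcb, hua, hub, hwaa, hwab, hwa', hwb, hea, heb⟩ :
      c ≠ a ∧ c ≠ b ∧ u ≠ a ∧ u ≠ b ∧ wa ≠ a ∧ wa ≠ b ∧ w ≠ a ∧ w ≠ b ∧ e ≠ a ∧ e ≠ b :=
    ⟨site_ne (Or.inl (by omega)), site_ne (Or.inl (by omega)), site_ne (Or.inr (by omega)),
      site_ne (Or.inl (by omega)), site_ne (Or.inl (by omega)), site_ne (Or.inl (by omega)),
      site_ne (Or.inl (by omega)), site_ne (Or.inr (by omega)), site_ne (Or.inl (by omega)),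
      site_ne (Or.inl (by omega))⟩
  -- the rectangle as a crux domain: `Ω_1` is the lattice graph on the open box
  have hface : x₀ ≤ x₀ ∧ x₀ + 1 ≤ x₁ ∧ y₀ ≤ y₀ ∧ y₀ + 1 ≤ y₁ := ⟨le_rfl, by omega, le_rfl, by omega⟩
  have hcross : pathCross x₀ y₀ (bx x₀ y₀) C.support.tail ≠ 0 := by rw [hpc]; decide
  have hdom : dom C 1 = Negative.Rect.Ω C := rfl
  have hadj : ∀ p q : Site 2, (discreteDomainGraph (dom C 1) 1).Adj p q ↔
      (zdGraph 2).Adj p q ∧ p ∈ Negative.Rect.box x₀ x₁ y₀ y₁ ∧ q ∈ Negative.Rect.box x₀ x₁ y₀ y₁ :=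
    fun p q => by rw [hdom]; exact Negative.Rect.dAdj_iff hbd hch hcomp hface hcross
  have hmesh : meshDomain (dom C 1) 1 = Negative.Rect.box x₀ x₁ y₀ y₁ := by
    rw [hdom]; exact Negative.Rect.meshDomain_Ω hbd hch hcomp hface hcross
  clear hface hcross
  -- lattice adjacencies and box memberships of the named sites
  have hAac : (zdGraph 2).Adj a c := by rw [ha, hc]; exact Negative.adj_bx _ _ _ _ (by omega)
  have hAau : (zdGraph 2).Adj a u := by rw [ha, hu]; exact Negative.adj_bx _ _ _ _ (by omega)
  have hAawa : (zdGraph 2).Adj a wa := by rw [ha, hwa]; exact Negative.adj_bx _ _ _ _ (by omega)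
  have hAcb : (zdGraph 2).Adj c b := by rw [hc, hb]; exact Negative.adj_bx _ _ _ _ (by omega)
  have hAwb : (zdGraph 2).Adj w b := by rw [hw, hb]; exact Negative.adj_bx _ _ _ _ (by omega)
  have hAeb : (zdGraph 2).Adj e b := by rw [he, hb]; exact Negative.adj_bx _ _ _ _ (by omega)
  obtain ⟨habox, hbbox, hcbox, hubox, hwbox⟩ : a ∈ Negative.Rect.box x₀ x₁ y₀ y₁ ∧
      b ∈ Negative.Rect.box x₀ x₁ y₀ y₁ ∧ c ∈ Negative.Rect.box x₀ x₁ y₀ y₁ ∧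
      u ∈ Negative.Rect.box x₀ x₁ y₀ y₁ ∧ w ∈ Negative.Rect.box x₀ x₁ y₀ y₁ :=
    ⟨(hbox a).2 (by omega), (hbox b).2 (by omega), (hbox c).2 (by omega), (hbox u).2 (by omega),
      (hbox w).2 (by omega)⟩
  -- chords: finiteness, heights, first and last steps
  haveI : Finite (SAW.DomainSAW (dom C 1) 1 a b) := finite_domainSAW C one_pos
  haveI : Fintype (SAW.DomainSAW (dom C 1) 1 a b) := Fintype.ofFinite _
  have hY : ∀ (γ : SAW.DomainSAW (dom C 1) 1 a b), ∀ v ∈ γ.walk.support, a 1 ≤ v 1 := by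
    intro γ v hv
    rcases support_subset_of_walk γ.walk v hv with h | h
    · rw [h]
    · rw [hmesh] at h
      obtain ⟨-, h1, -⟩ := h
      omega
  have hYb : ∀ (γ : SAW.DomainSAW (dom C 1) 1 a b), ∀ v ∈ γ.walk.support, b 1 ≤ v 1 :=
    fun γ v hv => by rw [hb1, ← ha1]; exact hY γ v hv
  have hlen : ∀ γ : SAW.DomainSAW (dom C 1) 1 a b, 0 < γ.walk.length := fun γ =>
    Nat.pos_of_ne_zero fun h0 => hab (γ.walk.eq_of_length_eq_zero h0)
  have hadj1 : ∀ γ : SAW.DomainSAW (dom C 1) 1 a b,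
      (discreteDomainGraph (dom C 1) 1).Adj a (γ.walk.getVert 1) := fun γ => by
    have h := γ.walk.adj_getVert_succ (hlen γ)
    rwa [Walk.getVert_zero] at h
  have hadj1R : ∀ γ : SAW.DomainSAW (dom C 1) 1 a b,
      (discreteDomainGraph (dom C 1) 1).Adj (γ.walk.reverse.getVert 1) b := fun γ => by
    have h := γ.walk.reverse.adj_getVert_succ (i := 0) (by rw [Walk.length_reverse]; exact hlen γ)
    rw [Walk.getVert_zero] at h
    exact h.symm
  have hfbox : ∀ γ : SAW.DomainSAW (dom C 1) 1 a b,
      γ.walk.getVert 1 ∈ Negative.Rect.box x₀ x₁ y₀ y₁ := fun γ => ((hadj _ _).1 (hadj1 γ)).2.2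
  have hlbox : ∀ γ : SAW.DomainSAW (dom C 1) 1 a b,
      γ.walk.reverse.getVert 1 ∈ Negative.Rect.box x₀ x₁ y₀ y₁ := fun γ => ((hadj _ _).1 (hadj1R γ)).2.1
  have hU : ∀ γ : SAW.DomainSAW (dom C 1) 1 a b,
      γ.walk.getVert 1 = c ∨ γ.walk.getVert 1 = u ∨ γ.walk.getVert 1 = wa := fun γ => by
    have h := nbr_cases ((hadj _ _).1 (hadj1 γ)).1 (hfbox γ) ha1
    rwa [ha0, ← hc, ← hu, ← hwa] at h
  have hW : ∀ γ : SAW.DomainSAW (dom C 1) 1 a b, γ.walk.reverse.getVert 1 = e ∨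
      γ.walk.reverse.getVert 1 = w ∨ γ.walk.reverse.getVert 1 = c := fun γ => by
    have h := nbr_cases ((hadj _ _).1 (hadj1R γ)).1.symm (hlbox γ) hb1
    rwa [hb0, show i + 2 + 1 = i + 3 by omega, show i + 2 - 1 = i + 1 by omega, ← he, ← hw, ← hc] at h
  -- the two events, `≼`-up-closed by first/last-step monotonicity at the bottom-row marked points
  obtain ⟨E, hE⟩ : ∃ E : Set (SAW.DomainSAW (dom C 1) 1 a b), ∀ γ, γ ∈ E ↔ γ.walk.getVert 1 ≠ c :=
    ⟨{γ | γ.walk.getVert 1 ≠ c}, fun _ => Iff.rfl⟩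
  obtain ⟨F, hF⟩ : ∃ F : Set (SAW.DomainSAW (dom C 1) 1 a b),
      ∀ γ, γ ∈ F ↔ γ.walk.reverse.getVert 1 ≠ c :=
    ⟨{γ | γ.walk.reverse.getVert 1 ≠ c}, fun _ => Iff.rfl⟩
  have hEup : IsUp E := by
    intro γ₁ γ₂ hlr h₁
    rw [hE] at h₁ ⊢
    intro h₂
    have key := ((stub_firstStepMonotone (dom C 1) a b γ₁ γ₂ hab hlr).1 (hY γ₁) (hY γ₂)).2
    rw [ha0, ha1, ← hc] at key
    exact h₁ (key h₂)
  have hFup : IsUp F := by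
    intro γ₁ γ₂ hlr h₁
    rw [hF] at h₁ ⊢
    intro h₂
    have key := ((stub_firstStepMonotone (dom C 1) a b γ₁ γ₂ hab hlr).2 (hYb γ₁) (hYb γ₂)).2
    rw [hb0, hb1, show i + 2 - 1 = i + 1 by omega, ← hc] at key
    exact h₁ (key h₂)
  -- THE CRUX, applied to the instance `(1, C, a, b, (i, y₀), (i+2, y₀))` and the events `E`, `F`
  have key : μx x (dom C 1) 1 a b E * μx x (dom C 1) 1 a b F ≤
      μx x (dom C 1) 1 a b Set.univ * μx x (dom C 1) 1 a b (E ∩ F) :=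
    hLR 1 (bx x₀ y₀) a b (bx i y₀) (bx (i + 2) y₀) C one_pos
      (hcomp i y₀ hi.le (by omega) le_rfl (by omega) (Or.inr (Or.inr (Or.inl rfl))))
      (hcomp (i + 2) y₀ (by omega) hi'.le le_rfl (by omega) (Or.inr (Or.inr (Or.inl rfl))))
      (by rw [ha]; exact Negative.adj_bx _ _ _ _ (by omega))
      (by rw [hb]; exact Negative.adj_bx _ _ _ _ (by omega)) E F hEup hFup
  rw [μx_apply_eq_ofReal hx0.le E, μx_apply_eq_ofReal hx0.le F, μx_apply_eq_ofReal hx0.le Set.univ,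
    μx_apply_eq_ofReal hx0.le (E ∩ F),
    ← ENNReal.ofReal_mul (Finset.sum_nonneg fun γ _ => pow_nonneg hx0.le _),
    ← ENNReal.ofReal_mul (Finset.sum_nonneg fun γ _ => pow_nonneg hx0.le _),
    ENNReal.ofReal_le_ofReal_iff (mul_nonneg (Finset.sum_nonneg fun γ _ => pow_nonneg hx0.le _)
      (Finset.sum_nonneg fun γ _ => pow_nonneg hx0.le _))] at key
  simp only [Finset.sum_filter, hE, hF, Set.mem_inter_iff, Set.mem_univ, if_true] at key
  -- the end-step matrix `M`, the kernels `Z` of the free graph; the four sums in terms of the nine entries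
  obtain ⟨M, hM⟩ : ∃ M : Site 2 → Site 2 → ℝ, ∀ p q, M p q =
      ∑ γ : SAW.DomainSAW (dom C 1) 1 a b,
        if γ.walk.getVert 1 = p ∧ γ.walk.reverse.getVert 1 = q then x ^ γ.length else 0 :=
    ⟨_, fun _ _ => rfl⟩
  obtain ⟨Z, hZ⟩ : ∃ Z : Site 2 → Site 2 → ℝ, ∀ p q, Z p q = (pathKernel G x p q).toReal :=
    ⟨_, fun _ _ => rfl⟩
  have hpw := fun γ : SAW.DomainSAW (dom C 1) 1 a b =>
    pointwise (x ^ γ.length) (hU γ) (hW γ) hcu hcwa huwa hcw hce hwe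
  rw [Fintype.sum_congr _ _ fun γ => (hpw γ).1, Fintype.sum_congr _ _ fun γ => (hpw γ).2.1,
    Fintype.sum_congr _ _ fun γ => (hpw γ).2.2.1, Fintype.sum_congr _ _ fun γ => (hpw γ).2.2.2] at key
  simp only [Finset.sum_add_distrib, ← hM] at key
  have ineq : (M u c + M wa c) * (M c w + M c e) ≤ M c c * (M u w + M u e + M wa w + M wa e) := by
    nlinarith [key]
  -- the class dictionary at `k = m = 0`: entries are `x²` times kernels of the free graph
  have hGfin' : (freeGraph (dom C 1) 1 0 (fun _ => a) 0 (fun _ => b)).support.Finite :=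
    support_freeGraph_finite (isBounded_dom C 1) one_pos 0 _ 0 _
  have hGfin : G.support.Finite := by rw [hG]; exact hGfin'
  have hGsupp : ∀ p : Site 2, p ∈ G.support → p ∈ Negative.Rect.box x₀ x₁ y₀ y₁ := fun p hp => by
    rw [hG] at hp
    have h := support_freeGraph_subset 0 (fun _ => a) 0 (fun _ => b) hp
    rwa [hmesh] at h
  have hfix : ∀ p : Site 2, p ≠ a → p ≠ b → p ∉ fixedSet 0 (fun _ : ℕ => a) 0 (fun _ : ℕ => b) := by
    rintro p hpa hpb (⟨_, _, h⟩ | ⟨_, _, h⟩)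
    exacts [hpa h.symm, hpb h.symm]
  have h2 : ∃ γ₁ γ₂ : SAW.DomainSAW (dom C 1) 1 a b,
      γ₁ ∈ cls 0 (fun _ => a) 0 (fun _ => b) ∧ γ₂ ∈ cls 0 (fun _ => a) 0 (fun _ => b) ∧ γ₁ ≠ γ₂ := by
    obtain ⟨γ₁, γ₂, h12⟩ := two_chords hadj hi hi' hy ha hb
    exact ⟨γ₁, γ₂, by rw [cls_zero]; exact Set.mem_univ _, by rw [cls_zero]; exact Set.mem_univ _, h12⟩
  have hdict : ∀ p q : Site 2, p ≠ a → p ≠ b → q ≠ a → q ≠ b →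
      (discreteDomainGraph (dom C 1) 1).Adj a p → (discreteDomainGraph (dom C 1) 1).Adj q b →
      M p q = x ^ 2 * Z p q := by
    intro p q hpa hpb hqa hqb hap hqb'
    have hkey := CornerAssembly.sum_dirSet_eq (k := 0) (π := fun _ => a) (m := 0) (σ := fun _ => b)
      (stub_classDictionary (dom C 1) 1 a b) h2 hGfin' hx0.le (hfix p hpa hpb) (hfix q hqa hqb) hap hqb'
    simp only [zero_add] at hkey
    rw [hM, hZ, hG, ← hkey, Finset.sum_filter]
    exact Finset.sum_congr rfl fun γ _ =>
      if_congr (by simp only [mem_dirSet, cls_zero, Set.mem_univ, true_and, zero_add]) rfl rfl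
  -- entries at wall sites vanish on both sides
  have hwall : ∀ p q : Site 2, p ∉ Negative.Rect.box x₀ x₁ y₀ y₁ → p ≠ q → M p q = x ^ 2 * Z p q := by
    intro p q hp hpq
    rw [hM, hZ, Finset.sum_eq_zero, BoundaryTP2.pathKernel_eq_zero_of_not_reachable G x
      (not_reachable_of_not_mem_support (fun h => hp (hGsupp p h)) hpq), ENNReal.toReal_zero, mul_zero]
    refine fun γ _ => if_neg ?_
    rintro ⟨h1, -⟩
    exact hp (h1 ▸ hfbox γ)
  have hwall' : ∀ p q : Site 2, q ∉ Negative.Rect.box x₀ x₁ y₀ y₁ → p ≠ q → M p q = x ^ 2 * Z p q := by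
    intro p q hq hpq
    rw [hM, hZ, Finset.sum_eq_zero, BoundaryTP2.pathKernel_comm,
      BoundaryTP2.pathKernel_eq_zero_of_not_reachable G x
        (not_reachable_of_not_mem_support (fun h => hq (hGsupp q h)) hpq.symm),
      ENNReal.toReal_zero, mul_zero]
    refine fun γ _ => if_neg ?_
    rintro ⟨-, h2⟩
    exact hq (h2 ▸ hlbox γ)
  -- the nine entries (`wₐ` and `e` may lie on the wall)
  have hDa : ∀ p : Site 2, (zdGraph 2).Adj a p → p ∈ Negative.Rect.box x₀ x₁ y₀ y₁ →
      (discreteDomainGraph (dom C 1) 1).Adj a p := fun p h hp => (hadj a p).2 ⟨h, habox, hp⟩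
  have hDb : ∀ q : Site 2, (zdGraph 2).Adj q b → q ∈ Negative.Rect.box x₀ x₁ y₀ y₁ →
      (discreteDomainGraph (dom C 1) 1).Adj q b := fun q h hq => (hadj q b).2 ⟨h, hq, hbbox⟩
  have vcol : ∀ p : Site 2, p ≠ a → p ≠ b → (discreteDomainGraph (dom C 1) 1).Adj a p → p ≠ e →
      M p e = x ^ 2 * Z p e := fun p hpa hpb hap hpe => by
    by_cases hxe : i + 3 < x₁
    · exact hdict p e hpa hpb hea heb hap (hDb e hAeb ((hbox e).2 (by omega)))
    · exact hwall' p e (fun h => hxe (by have h' := (hbox e).1 h; omega)) hpe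
  have vrow : ∀ q : Site 2, (wa ∈ Negative.Rect.box x₀ x₁ y₀ y₁ → M wa q = x ^ 2 * Z wa q) → wa ≠ q →
      M wa q = x ^ 2 * Z wa q := fun q hin hne => by
    by_cases hxa : x₀ < i - 1
    · exact hin ((hbox wa).2 (by omega))
    · exact hwall wa q (fun h => hxa (by have h' := (hbox wa).1 h; omega)) hne
  have vcc := hdict c c hca hcb hca hcb (hDa c hAac hcbox) (hDb c hAcb hcbox)
  have vcw := hdict c w hca hcb hwa' hwb (hDa c hAac hcbox) (hDb w hAwb hwbox)
  have vuc := hdict u c hua hub hca hcb (hDa u hAau hubox) (hDb c hAcb hcbox)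
  have vuw := hdict u w hua hub hwa' hwb (hDa u hAau hubox) (hDb w hAwb hwbox)
  have vce := vcol c hca hcb (hDa c hAac hcbox) hce
  have vue := vcol u hua hub (hDa u hAau hubox) (site_ne (Or.inl (by omega)))
  have vwac := vrow c (fun h => hdict wa c hwaa hwab hca hcb (hDa wa hAawa h) (hDb c hAcb hcbox)) hcwa.symm
  have vwaw := vrow w (fun h => hdict wa w hwaa hwab hwa' hwb (hDa wa hAawa h) (hDb w hAwb hwbox))
    (site_ne (Or.inl (by omega)))
  have vwae := vrow e (fun h => vcol wa hwaa hwab (hDa wa hAawa h) (site_ne (Or.inl (by omega))))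
    (site_ne (Or.inl (by omega)))
  have hZcc : Z c c = 1 := by rw [hZ, BoundaryTP2.pathKernel_self, ENNReal.toReal_one]
  rw [vcc, vcw, vce, vuc, vuw, vue, vwac, vwaw, vwae, hZcc] at ineq
  -- cancel `x ^ 4` and return to `ℝ≥0∞`
  have hZ0 : ∀ p q, 0 ≤ Z p q := fun p q => by rw [hZ]; exact ENNReal.toReal_nonneg
  have real_ineq : (Z u c + Z wa c) * (Z c w + Z c e) ≤ Z u w + Z u e + Z wa w + Z wa e := by
    refine le_of_mul_le_mul_left ?_ (pow_pos hx0 4)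
    nlinarith [ineq]
  have hK : ∀ p q, pathKernel G x p q = ENNReal.ofReal (Z p q) := fun p q => by
    rw [hZ, ENNReal.ofReal_toReal (BoundaryTP2.pathKernel_ne_top hGfin x p q)]
  rw [hK u c, hK wa c, hK c w, hK c e, hK u w, hK u e, hK wa w, hK wa e,
    ← ENNReal.ofReal_add (hZ0 u c) (hZ0 wa c), ← ENNReal.ofReal_add (hZ0 c w) (hZ0 c e),
    ← ENNReal.ofReal_mul (add_nonneg (hZ0 u c) (hZ0 wa c)),
    ← ENNReal.ofReal_add (hZ0 u w) (hZ0 u e),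
    ← ENNReal.ofReal_add (add_nonneg (hZ0 u w) (hZ0 u e)) (hZ0 wa w),
    ← ENNReal.ofReal_add (add_nonneg (add_nonneg (hZ0 u w) (hZ0 u e)) (hZ0 wa w)) (hZ0 wa e)]
  exact ENNReal.ofReal_le_ofReal real_ineq

end Summit.CriticalPhenomena.SAWScalingLimit.Theorems.LeftRightFKG.Families

end
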